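import Literature.MathematicalPhysics.QuantumFieldTheory.UnitaryCayleyChart
import Literature.MathematicalPhysics.QuantumFieldTheory.Balaban1983to89.T4RadialProjectionAC

/-!
# T4HaarUnitaryLocalDiffeo — LEMMA A on `U(N)`: a map with injective tangent differential on an open set pushes
# restricted Haar measure of the unitary group to an absolutely continuous measure (pub-balaban, row T4-D.G-EML-UN-K4*)

Pure measure theory / calculus over Mathlib and two tree modules; no Bałaban content, every declaration is [folklore].
PURPOSE ONLY (no journal text is typed here): this is the `U(N)` form, for EVERY `N`, of LEMMA A of `T4RadialProjectionAC`
(§1 there: a measurable self-map of a finite-dimensional real space with an invertible strict derivative at every point of an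
open set `O` pulls null sets back to null sets inside `O`), the analogue for the full unitary group
`𝔾 N = Matrix.unitaryGroup (Fin N) ℂ` of the `SU(2)` module `T4HaarSU2LocalDiffeo` (which went through the quaternion cone
picture of Haar measure on `SU(2)`, available only at `N = 2`).  Here the transfer between Haar measure and Lebesgue measure is
the tree's CAYLEY CHART of `U(N)` (`UnitaryCayleyChart`: `chart a = (2 + X)(2 - X)⁻¹`, `X = skewOf a`, `a ∈ ℝ^{N²}`, with the
two-sided comparison `c_N κ(r)^{-N²} vol ≤ chart^*Haar ≤ c_N vol` on `b(0, r)`, `r ≤ 1/2`, proved there softly from Lebesgue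
differentiation).  It is the map-independent engine toward absolute continuity of block-averaging push-forwards on `U(N)` /
`SU(N)` for `N ≥ 3` (the cell's node "BlockHaarAC with the printed outer average", closed in the tree at `N = 2` only); the
map-specific input (injectivity of the tangent differential of the concrete averaging law) is NOT here.

CONTENT.
* §1 Fréchet calculus of the Cayley transform on `M_N(ℂ)` (Frobenius norm, the scope of `UnitaryCayleyChart`; the statements
  are norm-independent): `hasStrictFDerivAt_cay` — `cay` has the strict real derivative `cayD X : Y ↦ 4 (2 - X)⁻¹ Y (2 - X)⁻¹`
  wherever `2 - X` is invertible (near such `X`, `cay Y = 4 · Ring.inverse (2 - Y) - 1`, `cay_eq_of_isUnit`, and Mathlib's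
  `hasStrictFDerivAt_ringInverse`); `exists_hasStrictFDerivAt_icay` — the inverse transform `icay` is strictly differentiable
  wherever `U + 1` is invertible; `isUnit_cay_add_one`; the real-linear coordinate maps `skewOfL : ℝ^{N²} →L M_N(ℂ)`,
  `unskewL : M_N(ℂ) →L ℝ^{N²}`; the TANGENT MAP `tang X Y = 4 (2 + X)⁻¹ Y (2 - X)⁻¹` with `cayD X Y = cay X * tang X Y`,
  `tang X Y` skew-Hermitian for skew-Hermitian `X, Y`, and `tang X Y = 0 → Y = 0`; the MOVING CHART
  `mchart U c = ↑U · cay (skewOf c) = ↑(U · chart c)` with strict derivative `mchartD U c`,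
  `mchartD U c v = ↑(U · chart c) · tang (skewOf c) (skewOf v)` (injective, values in the tangent space `↑(U · chart c) · 𝔲(N)`).
* §2 NULL-SET CRITERION for Haar measure `σ` of `U(N)`: `σ T = 0 ↔ ∀ V, vol (b̄(0,½) ∩ chart⁻¹(V⁻¹T)) = 0` (`haar_null_iff`;
  `→` by left invariance and the lower comparison, `←` by a countable cover of `U(N)` by translates of the chart neighbourhood
  `{‖U - 1‖ < 1/5} ⊆ chart(b̄(0,½))` and the upper comparison); a measurable left inverse `chartInv` of the chart
  (`Function.extend`).
* §3 MAIN THEOREM `haar_restrict_map_absolutelyContinuous_unitary`: `S ⊆ U(N)` open, `K : U(N) → U(N)` measurable, and an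
  ambient map `K♯ : M_N(ℂ) → M_N(ℂ)` with, for every `W ∈ S`, a strict real Fréchet derivative `D W` at `↑W`, `K♯ ↑W = ↑(K W)`,
  and TANGENT INJECTIVITY `∀ X, Xᴴ = -X → D W (↑W * X) = 0 → X = 0`.  Then `((σ).restrict S).map K ≪ σ` (and the whole-group corollary
  `haar_map_absolutelyContinuous_unitary`).  Proof: by §2 it
  suffices to show that for all `V, Vⱼ` the set of `b ∈ b̄(0,½)` with `V·chart b ∈ S`, `K(V·chart b) ∈ T ∩ Vⱼ{‖U-1‖<1/5}` is
  Lebesgue-null when `σ T = 0`; on the open set `O` where `V·chart b ∈ S` and `K♯(V·chart b) ∈ Vⱼ{‖·-1‖<1/5}` (open because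
  `K♯` is continuous at points of `S`) the LOCAL COORDINATE EXPRESSION `f = chartInv ∘ (Vⱼ⁻¹·) ∘ K ∘ (V·) ∘ chart` is
  measurable, agrees near each point with the smooth `unskew ∘ icay ∘ (Vⱼ⁻¹·) ∘ K♯ ∘ (V·) ∘ cay ∘ skewOf`, and its derivative
  `L` is injective: differentiating the germ identity `Vⱼ · cay (skewOf (f b')) = K♯ (V · cay (skewOf b'))` (uniqueness of the
  derivative) gives `D W (↑W · tang X (skewOf v)) = ↑Vⱼ · cayD (·) (skewOf (L v))`, so `L v = 0` forces `v = 0` by tangent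
  injectivity and §1 — no separate proof that `D W` maps tangent vectors to tangent vectors is needed; then §1 of
  `T4RadialProjectionAC` applies on `O` with the null target `b̄(0,½) ∩ chart⁻¹(Vⱼ⁻¹ T)`.

VALUE = kernel measure theory on `U(N)` (an engine for a named open node at `N ≥ 3`); NOT an estimate of the papers, NOT summit
progress.  The `SU(N)` form (Haar of `SU(N)` as the push-forward of Haar of `U(N)` under `U ↦ U · diag(det U, 1, …, 1)⁻¹`) is
not in this module.
-/

noncomputable section

open scoped Topology ENNReal
open Matrix MeasureTheory Set Metric Function Filter

namespace Literature.MathematicalPhysics.QuantumFieldTheory.Balaban1983to89.T4HaarUnitaryLocalDiffeo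

/- The Frobenius norm on `M_N(ℂ)` is the scope of `UnitaryCayleyChart`; it is opened inside this namespace only.  Every
STATEMENT below is norm-independent (`HasStrictFDerivAt` and `→L[ℝ]` only see the topology and the module structure of
`M_N(ℂ)`, which are the global ones), so the theorems apply verbatim to hypotheses elaborated in any other norm scope. -/
open scoped Matrix.Norms.Frobenius

open UnitaryCayley
open T4RadialProjectionAC (measure_inter_preimage_null_of_hasStrictFDerivAt)

variable {N : ℕ}

local notation "𝕄" => Matrix (Fin N) (Fin N) ℂ

/-! ## 1. Fréchet calculus of the Cayley transform -/

section Calculus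

/-- `(2 + X) + (2 - X) = 4 · 1` in `M_N(ℂ)`. [folklore] -/
theorem two_add_add_two_sub (X : 𝕄) : (2 : 𝕄) + X + (2 - X) = (4 : ℂ) • (1 : 𝕄) := by
  rw [show (2 : 𝕄) + X + (2 - X) = 2 + 2 by abel,
    show (4 : ℂ) = ((4 : ℕ) : ℂ) by norm_num, Nat.cast_smul_eq_nsmul, Nat.smul_one_eq_cast]
  norm_num

/-- The derivative of the Cayley transform at `X` (meaningful where `2 - X` is invertible): the continuous real-linear map
`Y ↦ 4 (2 - X)⁻¹ Y (2 - X)⁻¹`, written as the raw derivative of `Y ↦ 4 • Ring.inverse (2 - Y) - 1`. [folklore] -/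
def cayD (X : 𝕄) :=
  (4 : ℂ) • ((-ContinuousLinearMap.mulLeftRight ℝ 𝕄 (Ring.inverse (2 - X)) (Ring.inverse (2 - X))).comp
    (-ContinuousLinearMap.id ℝ 𝕄))

/-- The formula for `cayD`. [folklore] -/
theorem cayD_apply (X Y : 𝕄) : cayD X Y = (4 : ℂ) • ((2 - X)⁻¹ * Y * (2 - X)⁻¹) := by
  show (4 : ℂ) • -(Ring.inverse (2 - X) * -Y * Ring.inverse (2 - X)) = _
  rw [Matrix.mul_neg, Matrix.neg_mul, neg_neg, ← Matrix.nonsing_inv_eq_ringInverse]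

/-- Where `2 - Y` is invertible, `cay Y = 4 (2 - Y)⁻¹ - 1`. [folklore] -/
theorem cay_eq_of_isUnit {Y : 𝕄} (hY : IsUnit (2 - Y)) : cay Y = (4 : ℂ) • Ring.inverse (2 - Y) - 1 := by
  have hu := (isUnit_iff_isUnit_det _).1 hY
  have h2 : (2 : 𝕄) + Y = (4 : ℂ) • (1 : 𝕄) - (2 - Y) := by rw [← two_add_add_two_sub Y, add_sub_cancel_right]
  rw [cay, ← Matrix.nonsing_inv_eq_ringInverse, h2, Matrix.sub_mul, Matrix.smul_mul, Matrix.one_mul,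
    Matrix.mul_nonsing_inv _ hu]

/-- The set of `Y` with `2 - Y` invertible is open. [folklore] -/
theorem isOpen_setOf_isUnit_two_sub : IsOpen {Y : 𝕄 | IsUnit (2 - Y)} :=
  Units.isOpen.preimage (continuous_const.sub continuous_id)

/-- **The Cayley transform is strictly differentiable wherever `2 - X` is invertible**, with derivative `cayD X`
(near `X` it is `Y ↦ 4 • Ring.inverse (2 - Y) - 1`; derivative `H ↦ -A⁻¹ H A⁻¹` of `Ring.inverse` at a unit). [folklore] -/
theorem hasStrictFDerivAt_cay {X : 𝕄} (hX : IsUnit (2 - X)) : HasStrictFDerivAt cay (cayD X) X := by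
  obtain ⟨u, hu⟩ := hX
  have h2 := (hasStrictFDerivAt_id (𝕜 := ℝ) X).const_sub (2 : 𝕄)
  have h3 := hasStrictFDerivAt_ringInverse (𝕜 := ℝ) u
  rw [← Ring.inverse_unit, hu] at h3
  have h4 := ((h3.comp X h2).const_smul (4 : ℂ)).sub_const (1 : 𝕄)
  have hev : (fun Y : 𝕄 => (4 : ℂ) • Ring.inverse (2 - Y) - 1) =ᶠ[𝓝 X] cay := by
    filter_upwards [isOpen_setOf_isUnit_two_sub.mem_nhds (show IsUnit (2 - X) from ⟨u, hu⟩)] with Y hY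
    exact (cay_eq_of_isUnit hY).symm
  exact h4.congr_of_eventuallyEq hev

/-- `icay` through `Ring.inverse`. [folklore] -/
theorem icay_eq_smul_mul_ringInverse :
    (icay : 𝕄 → 𝕄) = fun U => (2 : ℂ) • ((U - 1) * Ring.inverse (U + 1)) := by
  funext U
  rw [icay, Matrix.nonsing_inv_eq_ringInverse]

/-- **The inverse Cayley transform is strictly differentiable wherever `U + 1` is invertible.** [folklore] -/
theorem exists_hasStrictFDerivAt_icay {U : 𝕄} (hU : IsUnit (U + 1)) :
    ∃ Di : 𝕄 →L[ℝ] 𝕄, HasStrictFDerivAt icay Di U := by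
  obtain ⟨u, hu⟩ := hU
  have h1 := (hasStrictFDerivAt_id (𝕜 := ℝ) U).sub_const (1 : 𝕄)
  have h2 := (hasStrictFDerivAt_id (𝕜 := ℝ) U).add_const (1 : 𝕄)
  have h3 := hasStrictFDerivAt_ringInverse (𝕜 := ℝ) u
  rw [hu] at h3
  have h4 := (h1.mul' (h3.comp U h2)).const_smul (2 : ℂ)
  rw [icay_eq_smul_mul_ringInverse]
  exact ⟨_, h4⟩

/-- `cay X + 1 = 4 (2 - X)⁻¹` for skew-Hermitian `X`. [folklore] -/
theorem cay_add_one {X : 𝕄} (hX : Xᴴ = -X) : cay X + 1 = (4 : ℂ) • (2 - X)⁻¹ := by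
  have hu := (isUnit_iff_isUnit_det _).1 (isUnit_two_sub hX)
  conv_lhs => rw [cay, ← Matrix.mul_nonsing_inv (2 - X) hu, ← Matrix.add_mul, two_add_add_two_sub]
  rw [Matrix.smul_mul, Matrix.one_mul]

/-- `cay X + 1` is invertible for skew-Hermitian `X` (inverse `(2 - X)/4`). [folklore] -/
theorem isUnit_cay_add_one {X : 𝕄} (hX : Xᴴ = -X) : IsUnit (cay X + 1) := by
  have hu := (isUnit_iff_isUnit_det _).1 (isUnit_two_sub hX)
  refine IsUnit.of_mul_eq_one ((4 : ℂ)⁻¹ • (2 - X)) ?_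
  rw [cay_add_one hX, Matrix.smul_mul, Matrix.mul_smul, smul_smul, Matrix.nonsing_inv_mul _ hu,
    mul_inv_cancel₀ (by norm_num : (4 : ℂ) ≠ 0), one_smul]

/-- `skewOf` as a continuous real-linear map `ℝ^{N²} →L M_N(ℂ)`. [folklore] -/
def skewOfL := (skewOf (N := N)).toContinuousLinearMap

/-- `skewOfL` is `skewOf`. [folklore] -/
@[simp] theorem skewOfL_apply (a : 𝔼 N) : skewOfL a = skewOf a := rfl

/-- `unskew` as a continuous real-linear map `M_N(ℂ) →L ℝ^{N²}`. [folklore] -/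
def unskewL : 𝕄 →L[ℝ] 𝔼 N :=
  LinearMap.toContinuousLinearMap
    { toFun := unskew
      map_add' := fun X Y => by
        ext p
        simp only [unskew_apply, Matrix.add_apply, Complex.add_re, Complex.add_im, PiLp.add_apply]
        ring
      map_smul' := fun c X => by
        ext p
        simp only [unskew_apply, Matrix.smul_apply, Complex.real_smul, Complex.mul_re, Complex.mul_im,
          Complex.ofReal_re, Complex.ofReal_im, PiLp.smul_apply, smul_eq_mul, RingHom.id_apply]
        ring }

/-- `unskewL` is `unskew`. [folklore] -/
@[simp] theorem unskewL_apply (X : 𝕄) : unskewL X = unskew X := rfl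

/-- The TANGENT MAP of the Cayley chart: `tang X Y = 4 (2 + X)⁻¹ Y (2 - X)⁻¹`, so that `cayD X Y = cay X · tang X Y`. [folklore] -/
def tang (X Y : 𝕄) : 𝕄 := (4 : ℂ) • ((2 + X)⁻¹ * Y * (2 - X)⁻¹)

/-- `cayD X Y = cay X · tang X Y` for skew-Hermitian `X`. [folklore] -/
theorem cayD_eq_cay_mul_tang {X : 𝕄} (hX : Xᴴ = -X) (Y : 𝕄) : cayD X Y = cay X * tang X Y := by
  have hu' := (isUnit_iff_isUnit_det _).1 (isUnit_two_add hX)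
  rw [cayD_apply, tang, Matrix.mul_smul, cay_eq_inv_mul hX]
  congr 1
  calc (2 - X)⁻¹ * Y * (2 - X)⁻¹ = (2 - X)⁻¹ * ((2 + X) * (2 + X)⁻¹) * Y * (2 - X)⁻¹ := by
        rw [Matrix.mul_nonsing_inv _ hu', Matrix.mul_one]
    _ = (2 - X)⁻¹ * (2 + X) * ((2 + X)⁻¹ * Y * (2 - X)⁻¹) := by simp only [Matrix.mul_assoc]

/-- `tang X Y` is skew-Hermitian for skew-Hermitian `X, Y`. [folklore] -/
theorem conjTranspose_tang {X Y : 𝕄} (hX : Xᴴ = -X) (hY : Yᴴ = -Y) : (tang X Y)ᴴ = -tang X Y := by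
  rw [tang, conjTranspose_smul, conjTranspose_mul, conjTranspose_mul, conjTranspose_nonsing_inv,
    conjTranspose_nonsing_inv, conjTranspose_two_sub hX, conjTranspose_two_add hX, hY]
  have h4 : star (4 : ℂ) = 4 := by rw [Complex.star_def, map_ofNat]
  rw [h4, Matrix.neg_mul, Matrix.mul_neg, smul_neg, Matrix.mul_assoc]

/-- `tang X Y = 0` forces `Y = 0` (for skew-Hermitian `X`). [folklore] -/
theorem eq_zero_of_tang_eq_zero {X Y : 𝕄} (hX : Xᴴ = -X) (h : tang X Y = 0) : Y = 0 := by
  have hu := (isUnit_iff_isUnit_det _).1 (isUnit_two_sub hX)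
  have hu' := (isUnit_iff_isUnit_det _).1 (isUnit_two_add hX)
  have key : (2 + X) * tang X Y * (2 - X) = (4 : ℂ) • Y := by
    rw [tang, Matrix.mul_smul, Matrix.smul_mul, ← Matrix.mul_assoc, ← Matrix.mul_assoc,
      Matrix.mul_nonsing_inv _ hu', Matrix.one_mul, Matrix.nonsing_inv_mul_cancel_right _ _ hu]
  rw [h, Matrix.mul_zero, Matrix.zero_mul] at key
  exact (smul_eq_zero.1 key.symm).resolve_left (by norm_num)

/-- `skewOf v = 0` forces `v = 0`. [folklore] -/
theorem eq_zero_of_skewOf_eq_zero {v : 𝔼 N} (h : skewOf v = 0) : v = 0 :=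
  (skewOf (N := N)).injective (by rw [h, map_zero])

/-- The MOVING CHART `c ↦ ↑U · cay (skewOf c)` (`= ↑(U · chart c)`) at `U ∈ U(N)`. [folklore] -/
def mchart (U : 𝔾 N) (c : 𝔼 N) : 𝕄 := (U : 𝕄) * cay (skewOf c)

/-- `mchart U c = ↑(U · chart c)`. [folklore] -/
theorem mchart_eq_coe (U : 𝔾 N) (c : 𝔼 N) : mchart U c = ((U * chart c : 𝔾 N) : 𝕄) := by
  rw [mchart, Submonoid.coe_mul, coe_chart]

/-- The derivative of the moving chart at `c`. [folklore] -/
def mchartD (U : 𝔾 N) (c : 𝔼 N) :=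
  (ContinuousLinearMap.mul ℝ 𝕄 (U : 𝕄)).comp ((cayD (skewOf c)).comp skewOfL)

/-- The moving chart is strictly differentiable everywhere, with derivative `mchartD U c`. [folklore] -/
theorem hasStrictFDerivAt_mchart (U : 𝔾 N) (c : 𝔼 N) : HasStrictFDerivAt (mchart U) (mchartD U c) c := by
  have h1 : HasStrictFDerivAt (fun c' : 𝔼 N => cay (skewOf c')) ((cayD (skewOf c)).comp skewOfL) c :=
    (hasStrictFDerivAt_cay (isUnit_two_sub (conjTranspose_skewOf c))).comp c skewOfL.hasStrictFDerivAt
  exact (ContinuousLinearMap.mul ℝ 𝕄 (U : 𝕄)).hasStrictFDerivAt.comp c h1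

/-- The moving chart is continuous. [folklore] -/
theorem continuous_mchart (U : 𝔾 N) : Continuous (mchart U) :=
  continuous_iff_continuousAt.2 fun c => (hasStrictFDerivAt_mchart U c).continuousAt

/-- The derivative of the moving chart takes values in the tangent space:
`mchartD U c v = ↑(U · chart c) · tang (skewOf c) (skewOf v)`. [folklore] -/
theorem mchartD_apply (U : 𝔾 N) (c v : 𝔼 N) :
    mchartD U c v = ((U * chart c : 𝔾 N) : 𝕄) * tang (skewOf c) (skewOf v) := by
  show (U : 𝕄) * cayD (skewOf c) (skewOf v) = _
  rw [cayD_eq_cay_mul_tang (conjTranspose_skewOf c), ← Matrix.mul_assoc, Submonoid.coe_mul, coe_chart]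

end Calculus

/-! ## 2. Haar-null sets of `U(N)` through the Cayley chart -/

section NullCriterion

/-- `(1/2)/κ(1/2) = 1/5`. [folklore] -/
theorem half_div_κ_half : (1 / 2 : ℝ) / κ (1 / 2) = 1 / 5 := by norm_num [κ]

variable (N) in
/-- The chart neighbourhood `{U : ‖U - 1‖_F < 1/5}` of `1 ∈ U(N)` (inside `chart(b̄(0, 1/2))`). [folklore] -/
def nbhd : Set (𝔾 N) := {U | ‖(U : 𝕄) - 1‖ < 1 / 5}

/-- The chart neighbourhood is open. [folklore] -/
theorem isOpen_nbhd : IsOpen (nbhd N) := isOpen_lt (continuous_norm_coe_sub 1) continuous_const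

/-- `1` lies in the chart neighbourhood. [folklore] -/
theorem one_mem_nbhd : (1 : 𝔾 N) ∈ nbhd N := by
  simp only [nbhd, mem_setOf_eq, OneMemClass.coe_one, sub_self, norm_zero]
  norm_num

/-- The chart neighbourhood lies in the chart image of the closed ball of radius `1/2`. [folklore] -/
theorem nbhd_subset_image_chart : nbhd N ⊆ chart '' closedBall (0 : 𝔼 N) (1 / 2) := by
  intro U hU
  have h := gball_subset_image_chart (N := N) (by norm_num : (0 : ℝ) ≤ 1 / 2) le_rfl
  rw [half_div_κ_half] at h
  exact h (mem_gball.2 (le_of_lt hU))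

/-- The left translate `V · nbhd` as a preimage; it is an open neighbourhood of `V`. [folklore] -/
theorem translate_nbhd_mem_nhds (V : 𝔾 N) : (fun U => V⁻¹ * U) ⁻¹' nbhd N ∈ 𝓝 V :=
  (isOpen_nbhd.preimage (continuous_const_mul V⁻¹)).mem_nhds
    (show V⁻¹ * V ∈ nbhd N by rw [inv_mul_cancel]; exact one_mem_nbhd)

/-- A countable set of translates of the chart neighbourhood covers `U(N)`. [folklore] -/
theorem exists_countable_cover :
    ∃ C : Set (𝔾 N), C.Countable ∧ ⋃ V ∈ C, (fun U => V⁻¹ * U) ⁻¹' nbhd N = univ :=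
  TopologicalSpace.countable_cover_nhds translate_nbhd_mem_nhds

/-- **Null criterion, `→`**: if `T` is Haar-null then for every `V` the chart preimage of `V⁻¹ T` inside `b̄(0, 1/2)` is
Lebesgue-null (left invariance and the lower comparison `c vol ≤ chart^* Haar` on `b̄(0, 1/2)`). [folklore] -/
theorem volume_null_of_haar_null {T : Set (𝔾 N)} (hT : haarProbability (𝔾 N) T = 0) (V : 𝔾 N) :
    volume (closedBall (0 : 𝔼 N) (1 / 2) ∩ chart ⁻¹' ((fun U => V * U) ⁻¹' T)) = 0 := by
  set s := closedBall (0 : 𝔼 N) (1 / 2) ∩ chart ⁻¹' ((fun U => V * U) ⁻¹' T) with hs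
  have h1 : chartMeasure N s = 0 := by
    rw [chartMeasure_apply]
    refine measure_mono_null ?_ ((measure_preimage_mul (haarProbability (𝔾 N)) V T).trans hT)
    rintro _ ⟨b, hb, rfl⟩
    exact hb.2
  have h2 := le_chartMeasure_of_subset (N := N) (by norm_num : (0 : ℝ) < 1 / 2) le_rfl (s := s) inter_subset_left
  rw [h1, nonpos_iff_eq_zero, mul_eq_zero] at h2
  exact h2.resolve_left (lowerConst_ne_zero _)

/-- **Null criterion, `←`**: if for every `V` the chart preimage of `V⁻¹ T` inside `b̄(0, 1/2)` is Lebesgue-null, then `T`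
is Haar-null (countable cover by translates of the chart neighbourhood and the upper comparison `chart^* Haar ≤ c_N vol`). [folklore] -/
theorem haar_null_of_forall_volume_null {T : Set (𝔾 N)}
    (h : ∀ V : 𝔾 N, volume (closedBall (0 : 𝔼 N) (1 / 2) ∩ chart ⁻¹' ((fun U => V * U) ⁻¹' T)) = 0) :
    haarProbability (𝔾 N) T = 0 := by
  obtain ⟨C, hCc, hCU⟩ := exists_countable_cover (N := N)
  have hTsub : T ⊆ ⋃ V ∈ C, T ∩ (fun U => V⁻¹ * U) ⁻¹' nbhd N := by
    intro U hU
    have hU' : U ∈ ⋃ V ∈ C, (fun U => V⁻¹ * U) ⁻¹' nbhd N := by rw [hCU]; trivial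
    simp only [mem_iUnion] at hU' ⊢
    obtain ⟨V, hV, hUV⟩ := hU'
    exact ⟨V, hV, hU, hUV⟩
  refine measure_mono_null hTsub ((measure_biUnion_null_iff hCc).2 fun V _ => ?_)
  rw [← measure_preimage_mul (haarProbability (𝔾 N)) V]
  have hsub : (fun U => V * U) ⁻¹' (T ∩ (fun U => V⁻¹ * U) ⁻¹' nbhd N) ⊆
      chart '' (closedBall (0 : 𝔼 N) (1 / 2) ∩ chart ⁻¹' ((fun U => V * U) ⁻¹' T)) := by
    intro U hU
    simp only [mem_preimage, mem_inter_iff, inv_mul_cancel_left] at hU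
    obtain ⟨b, hb, hbU⟩ := nbhd_subset_image_chart hU.2
    refine ⟨b, ⟨hb, ?_⟩, hbU⟩
    show V * chart b ∈ T
    rw [hbU]; exact hU.1
  refine measure_mono_null hsub ?_
  rw [← chartMeasure_apply]
  have hle := chartMeasure_le (N := N) (closedBall (0 : 𝔼 N) (1 / 2) ∩ chart ⁻¹' ((fun U => V * U) ⁻¹' T))
  rw [h V, mul_zero, nonpos_iff_eq_zero] at hle
  exact hle

/-- **NULL CRITERION**: a set `T ⊆ U(N)` is Haar-null iff the chart preimages of all its left translates inside the closed
ball of radius `1/2` are Lebesgue-null. [folklore] -/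
theorem haar_null_iff (T : Set (𝔾 N)) :
    haarProbability (𝔾 N) T = 0 ↔
      ∀ V : 𝔾 N, volume (closedBall (0 : 𝔼 N) (1 / 2) ∩ chart ⁻¹' ((fun U => V * U) ⁻¹' T)) = 0 :=
  ⟨fun hT V => volume_null_of_haar_null hT V, haar_null_of_forall_volume_null⟩

/-- A measurable left inverse of the chart on all of `U(N)` (`Function.extend`; equal to `ichart` on the range). [folklore] -/
def chartInv : 𝔾 N → 𝔼 N := Function.extend chart id fun _ => 0

/-- `chartInv (chart a) = a`. [folklore] -/
@[simp] theorem chartInv_chart (a : 𝔼 N) : chartInv (chart a) = a :=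
  chart_injective.extend_apply _ _ a

/-- `chartInv` is measurable. [folklore] -/
theorem measurable_chartInv : Measurable (chartInv (N := N)) :=
  measurableEmbedding_chart.measurable_extend measurable_id measurable_const

end NullCriterion

/-! ## 3. The main theorem -/

section Main

/-- THE LOCAL COORDINATE EXPRESSION HAS AN INVERTIBLE DERIVATIVE.  Data: `S` open, `K`, `K♯`, `D` as in the main theorem; `V, Vⱼ ∈ U(N)`;
an open set `O` of parameters on which `V · chart b' ∈ S` and `Vⱼ⁻¹ · K (V · chart b')` lies in the chart neighbourhood.  Then at
every `b ∈ O` the map `f : b' ↦ chartInv (Vⱼ⁻¹ · K (V · chart b'))` has an INVERTIBLE strict derivative.  (Near `b`, `f` is the smooth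
`unskew ∘ icay ∘ (Vⱼ⁻¹·) ∘ K♯ ∘ (V·) ∘ cay ∘ skewOf`; its derivative `L` satisfies `mchartD Vⱼ (f b) ∘ L = D W ∘ mchartD V b`,
`W = V · chart b`, by differentiating `mchart Vⱼ ∘ f = K♯ ∘ mchart V` on `O`; so `L v = 0` gives `D W (↑W · tang X (skewOf v)) = 0`,
whence `v = 0` by tangent injectivity.) [folklore] -/
theorem exists_equiv_hasStrictFDerivAt_localCoord {S : Set (𝔾 N)} {K : 𝔾 N → 𝔾 N} {Kmat : 𝕄 → 𝕄}
    {D : 𝔾 N → 𝕄 →L[ℝ] 𝕄} (hd : ∀ W ∈ S, HasStrictFDerivAt Kmat (D W) (W : 𝕄))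
    (hKmat : ∀ W ∈ S, Kmat (W : 𝕄) = ((K W : 𝔾 N) : 𝕄))
    (hinj : ∀ W ∈ S, ∀ X : 𝕄, Xᴴ = -X → D W ((W : 𝕄) * X) = 0 → X = 0)
    (V Vj : 𝔾 N) {O : Set (𝔼 N)} (hO : IsOpen O) (hOS : ∀ b' ∈ O, V * chart b' ∈ S)
    (hOj : ∀ b' ∈ O, Vj⁻¹ * K (V * chart b') ∈ nbhd N) {b : 𝔼 N} (hb : b ∈ O) :
    ∃ E : 𝔼 N ≃L[ℝ] 𝔼 N,
      HasStrictFDerivAt (fun b' => chartInv (Vj⁻¹ * K (V * chart b'))) (E : 𝔼 N →L[ℝ] 𝔼 N) b := by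
  set W : 𝔾 N := V * chart b with hW
  have hWS : W ∈ S := hOS b hb
  have hXh : (skewOf b)ᴴ = -skewOf b := conjTranspose_skewOf b
  -- `K♯ ∘ mchart V` is strictly differentiable at `b`
  have hVb : mchart V b = (W : 𝕄) := mchart_eq_coe V b
  have hKd : HasStrictFDerivAt Kmat (D W) (mchart V b) := by rw [hVb]; exact hd W hWS
  have hKΦ : HasStrictFDerivAt (fun b' => Kmat (mchart V b')) ((D W).comp (mchartD V b)) b :=
    hKd.comp b (hasStrictFDerivAt_mchart V b)
  -- the image point `Vⱼ⁻¹ K W` is a chart point `chart c₀`, `c₀ ∈ b̄(0, 1/2)`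
  obtain ⟨c₀, -, hc₀⟩ := nbhd_subset_image_chart (hOj b hb)
  have hpt : ((Vj⁻¹ : 𝔾 N) : 𝕄) * Kmat (mchart V b) = ((Vj⁻¹ * K W : 𝔾 N) : 𝕄) := by
    rw [hVb, hKmat W hWS, Submonoid.coe_mul]
  have hunit : IsUnit (((Vj⁻¹ : 𝔾 N) : 𝕄) * Kmat (mchart V b) + 1) := by
    rw [hpt, ← hc₀, coe_chart]; exact isUnit_cay_add_one (conjTranspose_skewOf c₀)
  obtain ⟨Di, hDi⟩ := exists_hasStrictFDerivAt_icay hunit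
  -- the smooth expression `g` and its derivative `L`
  have hmulj : HasStrictFDerivAt (fun M : 𝕄 => ((Vj⁻¹ : 𝔾 N) : 𝕄) * M)
      (ContinuousLinearMap.mul ℝ 𝕄 ((Vj⁻¹ : 𝔾 N) : 𝕄)) (Kmat (mchart V b)) :=
    (ContinuousLinearMap.mul ℝ 𝕄 ((Vj⁻¹ : 𝔾 N) : 𝕄)).hasStrictFDerivAt
  have hg : HasStrictFDerivAt (fun b' => unskewL (icay (((Vj⁻¹ : 𝔾 N) : 𝕄) * Kmat (mchart V b'))))
      (unskewL.comp (Di.comp ((ContinuousLinearMap.mul ℝ 𝕄 ((Vj⁻¹ : 𝔾 N) : 𝕄)).comp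
        ((D W).comp (mchartD V b))))) b :=
    unskewL.hasStrictFDerivAt.comp b (hDi.comp b (hmulj.comp b hKΦ))
  set L : 𝔼 N →L[ℝ] 𝔼 N := unskewL.comp (Di.comp ((ContinuousLinearMap.mul ℝ 𝕄 ((Vj⁻¹ : 𝔾 N) : 𝕄)).comp
    ((D W).comp (mchartD V b)))) with hL
  -- on `O`, every image point is a chart point
  have hchart : ∀ b' ∈ O, ∃ c ∈ closedBall (0 : 𝔼 N) (1 / 2), chart c = Vj⁻¹ * K (V * chart b') :=
    fun b' hb' => nbhd_subset_image_chart (hOj b' hb')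
  -- `f = g` on `O`
  have hfg : (fun b' => unskewL (icay (((Vj⁻¹ : 𝔾 N) : 𝕄) * Kmat (mchart V b')))) =ᶠ[𝓝 b]
      fun b' => chartInv (Vj⁻¹ * K (V * chart b')) := by
    filter_upwards [hO.mem_nhds hb] with b' hb'
    obtain ⟨c, -, hc⟩ := hchart b' hb'
    rw [← hc, chartInv_chart, unskewL_apply, mchart_eq_coe, hKmat _ (hOS b' hb'), ← Submonoid.coe_mul, ← hc,
      coe_chart, icay_cay (conjTranspose_skewOf c), unskew_skewOf]
  have hf : HasStrictFDerivAt (fun b' => chartInv (Vj⁻¹ * K (V * chart b'))) L b :=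
    hg.congr_of_eventuallyEq hfg
  -- the germ identity `mchart Vⱼ ∘ f = K♯ ∘ mchart V` on `O`
  have hgerm : (fun b' => mchart Vj (chartInv (Vj⁻¹ * K (V * chart b')))) =ᶠ[𝓝 b]
      fun b' => Kmat (mchart V b') := by
    filter_upwards [hO.mem_nhds hb] with b' hb'
    obtain ⟨c, -, hc⟩ := hchart b' hb'
    rw [← hc, chartInv_chart, mchart_eq_coe, hc, mul_inv_cancel_left, mchart_eq_coe, hKmat _ (hOS b' hb')]
  have hR : HasStrictFDerivAt (fun b' => mchart Vj (chartInv (Vj⁻¹ * K (V * chart b'))))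
      ((mchartD Vj (chartInv (Vj⁻¹ * K (V * chart b)))).comp L) b :=
    (hasStrictFDerivAt_mchart Vj _).comp b hf
  have heq : (mchartD Vj (chartInv (Vj⁻¹ * K (V * chart b)))).comp L = (D W).comp (mchartD V b) :=
    (hR.hasFDerivAt.congr_of_eventuallyEq hgerm.symm).unique hKΦ.hasFDerivAt
  -- injectivity of `L`
  have hLinj : Function.Injective L := by
    refine (injective_iff_map_eq_zero L).2 fun v hv => ?_
    have h1 : mchartD Vj (chartInv (Vj⁻¹ * K (V * chart b))) (L v) = D W (mchartD V b v) :=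
      DFunLike.congr_fun heq v
    rw [hv, map_zero, mchartD_apply] at h1
    have htang : tang (skewOf b) (skewOf v) = 0 :=
      hinj W hWS _ (conjTranspose_tang hXh (conjTranspose_skewOf v)) h1.symm
    exact eq_zero_of_skewOf_eq_zero (eq_zero_of_tang_eq_zero hXh htang)
  refine ⟨(LinearEquiv.ofInjectiveEndo L.toLinearMap hLinj).toContinuousLinearEquiv, hf.congr_fderiv ?_⟩
  ext v
  rfl

/-- THE PIECE OF THE BAD SET SEEN IN ONE PAIR OF CHARTS IS NULL.  For `σ T = 0`, `T` measurable, and `V, Vⱼ ∈ U(N)`: the set of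
`b ∈ b̄(0, 1/2)` with `V · chart b ∈ S`, `K (V · chart b) ∈ T` and `Vⱼ⁻¹ · K (V · chart b)` in the chart neighbourhood is
Lebesgue-null (LEMMA A of `T4RadialProjectionAC` for the local coordinate expression on the open set `O`). [folklore] -/
theorem volume_piece_null {S : Set (𝔾 N)} (hS : IsOpen S) {K : 𝔾 N → 𝔾 N} (hK : Measurable K) {Kmat : 𝕄 → 𝕄}
    {D : 𝔾 N → 𝕄 →L[ℝ] 𝕄} (hd : ∀ W ∈ S, HasStrictFDerivAt Kmat (D W) (W : 𝕄))
    (hKmat : ∀ W ∈ S, Kmat (W : 𝕄) = ((K W : 𝔾 N) : 𝕄))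
    (hinj : ∀ W ∈ S, ∀ X : 𝕄, Xᴴ = -X → D W ((W : 𝕄) * X) = 0 → X = 0)
    {T : Set (𝔾 N)} (hT : MeasurableSet T) (hT0 : haarProbability (𝔾 N) T = 0) (V Vj : 𝔾 N) :
    volume (closedBall (0 : 𝔼 N) (1 / 2) ∩ chart ⁻¹' ((fun U => V * U) ⁻¹' (K ⁻¹' T ∩ S)) ∩
      (fun b => Vj⁻¹ * K (V * chart b)) ⁻¹' nbhd N) = 0 := by
  -- an ambient open set `Q ⊆ M_N(ℂ)` cutting out the translate `Vⱼ · nbhd`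
  obtain ⟨Q, hQo, hQ⟩ : ∃ Q : Set 𝕄, IsOpen Q ∧ Subtype.val ⁻¹' Q = (fun U => Vj⁻¹ * U) ⁻¹' nbhd N :=
    isOpen_induced_iff.1 (isOpen_nbhd.preimage (continuous_const_mul Vj⁻¹))
  -- the open set `O`
  set O : Set (𝔼 N) := {b | V * chart b ∈ S} ∩ (fun b => Kmat (mchart V b)) ⁻¹' Q with hO_def
  have hPo : IsOpen {b : 𝔼 N | V * chart b ∈ S} := hS.preimage ((continuous_const_mul V).comp continuous_chart)
  have hcont : ContinuousOn (fun b => Kmat (mchart V b)) {b : 𝔼 N | V * chart b ∈ S} := by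
    intro b hb
    have h1 : ContinuousAt Kmat (mchart V b) := by rw [mchart_eq_coe]; exact (hd _ hb).continuousAt
    exact (h1.comp (continuous_mchart V).continuousAt).continuousWithinAt
  have hO : IsOpen O := hcont.isOpen_inter_preimage hPo hQo
  have hOS : ∀ b' ∈ O, V * chart b' ∈ S := fun b' hb' => hb'.1
  have hmemQ : ∀ b', V * chart b' ∈ S → (Kmat (mchart V b') ∈ Q ↔ Vj⁻¹ * K (V * chart b') ∈ nbhd N) := by
    intro b' hb'
    have h' : (K (V * chart b') ∈ Subtype.val ⁻¹' Q ↔ K (V * chart b') ∈ (fun U => Vj⁻¹ * U) ⁻¹' nbhd N) := by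
      rw [hQ]
    rw [mchart_eq_coe, hKmat _ hb']
    exact h'
  have hOj : ∀ b' ∈ O, Vj⁻¹ * K (V * chart b') ∈ nbhd N := fun b' hb' => (hmemQ b' hb'.1).1 hb'.2
  -- the local coordinate expression and the null target
  set f : 𝔼 N → 𝔼 N := fun b => chartInv (Vj⁻¹ * K (V * chart b)) with hf_def
  have hfm : Measurable f :=
    measurable_chartInv.comp ((measurable_const_mul _).comp (hK.comp
      (((continuous_const_mul V).comp continuous_chart).measurable)))
  set Nj : Set (𝔼 N) := closedBall (0 : 𝔼 N) (1 / 2) ∩ chart ⁻¹' ((fun U => Vj * U) ⁻¹' T) with hNj_def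
  have hNjm : MeasurableSet Nj :=
    measurableSet_closedBall.inter (((continuous_const_mul Vj).comp continuous_chart).measurable hT)
  have hNj0 : volume Nj = 0 := volume_null_of_haar_null hT0 Vj
  -- the piece lies in `O ∩ f⁻¹ Nⱼ`
  have hsub : closedBall (0 : 𝔼 N) (1 / 2) ∩ chart ⁻¹' ((fun U => V * U) ⁻¹' (K ⁻¹' T ∩ S)) ∩
      (fun b => Vj⁻¹ * K (V * chart b)) ⁻¹' nbhd N ⊆ O ∩ f ⁻¹' Nj := by
    rintro b ⟨⟨-, hbT, hbS⟩, hbj⟩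
    rw [mem_preimage] at hbj
    refine ⟨⟨hbS, (hmemQ b hbS).2 hbj⟩, ?_⟩
    obtain ⟨c, hc, hcU⟩ := nbhd_subset_image_chart hbj
    have hfb : f b = c := by rw [hf_def]; dsimp only; rw [← hcU, chartInv_chart]
    rw [mem_preimage, hfb]
    refine ⟨hc, ?_⟩
    show Vj * chart c ∈ T
    rw [hcU, mul_inv_cancel_left]; exact hbT
  refine measure_mono_null hsub ?_
  have key : ∀ b ∈ O, ∃ E : 𝔼 N ≃L[ℝ] 𝔼 N, HasStrictFDerivAt f (E : 𝔼 N →L[ℝ] 𝔼 N) b := fun b hb =>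
    exists_equiv_hasStrictFDerivAt_localCoord hd hKmat hinj V Vj hO hOS hOj hb
  choose! E hE using key
  exact measure_inter_preimage_null_of_hasStrictFDerivAt volume hO hNjm hfm (f' := E) hE hNj0

/-- **MAIN THEOREM: LEMMA A ON `U(N)` FOR AN AMBIENT MATRIX MAP.**  Let `S ⊆ U(N)` be open, `K : U(N) → U(N)` measurable, and
`K♯ : M_N(ℂ) → M_N(ℂ)` an ambient map with, for every `W ∈ S`: a strict real Fréchet derivative `D W` at `↑W`, `K♯ ↑W = ↑(K W)`,
and TANGENT INJECTIVITY — `D W` kills no non-zero tangent vector `↑W · X` (`Xᴴ = -X`) of `U(N)` at `W`.  Then the push-forward of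
Haar measure restricted to `S` is absolutely continuous: `((Haar).restrict S).map K ≪ Haar`. [folklore] -/
theorem haar_restrict_map_absolutelyContinuous_unitary {S : Set (𝔾 N)} (hS : IsOpen S)
    {K : 𝔾 N → 𝔾 N} (hK : Measurable K) {Kmat : 𝕄 → 𝕄} {D : 𝔾 N → 𝕄 →L[ℝ] 𝕄}
    (hd : ∀ W ∈ S, HasStrictFDerivAt Kmat (D W) (W : 𝕄))
    (hKmat : ∀ W ∈ S, Kmat (W : 𝕄) = ((K W : 𝔾 N) : 𝕄))
    (hinj : ∀ W ∈ S, ∀ X : 𝕄, Xᴴ = -X → D W ((W : 𝕄) * X) = 0 → X = 0) :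
    ((haarProbability (𝔾 N)).restrict S).map K ≪ haarProbability (𝔾 N) := by
  refine Measure.AbsolutelyContinuous.mk fun T hT hT0 => ?_
  rw [Measure.map_apply hK hT, Measure.restrict_apply (hK hT)]
  refine haar_null_of_forall_volume_null fun V => ?_
  obtain ⟨C, hCc, hCU⟩ := exists_countable_cover (N := N)
  set A := closedBall (0 : 𝔼 N) (1 / 2) ∩ chart ⁻¹' ((fun U => V * U) ⁻¹' (K ⁻¹' T ∩ S)) with hA_def
  have hAsub : A ⊆ ⋃ Vj ∈ C, A ∩ (fun b => Vj⁻¹ * K (V * chart b)) ⁻¹' nbhd N := by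
    intro b hb
    have hb' : K (V * chart b) ∈ ⋃ Vj ∈ C, (fun U => Vj⁻¹ * U) ⁻¹' nbhd N := by rw [hCU]; trivial
    simp only [mem_iUnion] at hb' ⊢
    obtain ⟨Vj, hVj, hbj⟩ := hb'
    exact ⟨Vj, hVj, hb, hbj⟩
  exact measure_mono_null hAsub ((measure_biUnion_null_iff hCc).2 fun Vj _ =>
    volume_piece_null hS hK hd hKmat hinj hT hT0 V Vj)

/-- **COROLLARY (whole group).**  If `K♯` has a strict real derivative with TANGENT INJECTIVITY at every point of `U(N)` and
agrees with `K` there, then `Haar.map K ≪ Haar`. [folklore] -/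
theorem haar_map_absolutelyContinuous_unitary {K : 𝔾 N → 𝔾 N} (hK : Measurable K) {Kmat : 𝕄 → 𝕄}
    {D : 𝔾 N → 𝕄 →L[ℝ] 𝕄} (hd : ∀ W : 𝔾 N, HasStrictFDerivAt Kmat (D W) (W : 𝕄))
    (hKmat : ∀ W : 𝔾 N, Kmat (W : 𝕄) = ((K W : 𝔾 N) : 𝕄))
    (hinj : ∀ W : 𝔾 N, ∀ X : 𝕄, Xᴴ = -X → D W ((W : 𝕄) * X) = 0 → X = 0) :
    (haarProbability (𝔾 N)).map K ≪ haarProbability (𝔾 N) := by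
  have h := haar_restrict_map_absolutelyContinuous_unitary (N := N) isOpen_univ hK (fun W _ => hd W)
    (fun W _ => hKmat W) (fun W _ => hinj W)
  rwa [Measure.restrict_univ] at h

end Main

end Literature.MathematicalPhysics.QuantumFieldTheory.Balaban1983to89.T4HaarUnitaryLocalDiffeo

end
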